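import Summits.CriticalPhenomena.PercolationContinuityZ3.Theorems.PercNearOneGluingNoHeavyLowerTailThreePartitionCubeCheckPacked

/-!
# Twisted three-partition positivity (★★) = (M⁺-3) on SIX letters: pair-saturation check, **chunk `chunk_x11_5_0`** (first point `11` (code), node hash `≡ 0 (mod 5)`)

Support file (cell `prim-sahi`, seat `prim-sahi-typer` gen 34; `--supports stmt-CriticalPhenomena-4575`, COMPUTATIONAL).  One `native_decide`
evaluation of `ThreePartition.Cube.chunkCheck 6 sel M r` of `…ThreePartitionCubeCheckPacked` (`sel = 2048`, `M = 5`, `r = 0`): every admissible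
2-colouring of every antichain of `2^[6]` in this chunk passes, for all 64 twists, the packed transport test (relative dual-cone criterion) or its exact
scalar fall-back.  The soundness theorem turning the 27 chunks into `threePartNT τ 𝒰 𝒱 𝒲 ≥ 0` on `2^(Fin 6)` lives in companion files; nothing is
asserted here beyond the Boolean evaluation.  Reference counts: C program `c63b.c` (memo FROM-prim-sahi-typer-gen34-PAIR-SATURATION-CUBE.md).
[this work] [computational]
-/

namespace Summit.CriticalPhenomena.PercolationContinuityZ3.Theorems.ThreePartition.Cube

/-- **Chunk `chunk_x11_5_0`** of the six-letter pair-saturation check passes (`native_decide`). [this work] [computational] -/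
theorem chunk_x11_5_0 : chunkCheck 6 2048 5 0 = true := by native_decide

end Summit.CriticalPhenomena.PercolationContinuityZ3.Theorems.ThreePartition.Cube
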